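import Summits.QuantumFields.BalabanUV.T4Continuum.Support.NE7ApeTrivialFlatEndLinks
import Summits.QuantumFields.BalabanUV.T4Continuum.Support.NE7RepFlatLinksOfTanCritical
import HarnessLib

/-!
# NE7ApeTrivialFlatEndCritical — (APE) AT THE TRIVIAL FLAT DATUM FROM TANGENT-CRITICALITY ALONE: G7's link binders `(u₀, r₀, r₁)` and every numeric line
# DISCHARGED by ROAD v4's REP♭⁻ (`NE7RepFlatLinksOfTanCritical.exists_rep_flat_links_critical`), so `SmallField U (K′δ²∕M²)` follows from `SmallField U (δ∕M²)`,
# block-flatness and tangent-criticality for `δ ≤ θ`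

Cell `pub-balaban`, rung (B)+1 sub-cell t4, lineage `b2b-balaban-t4-ne7-p1`, generation 74 (CRUX PROVER NE7 #1, OWNER row NE7).  Memo `REP-FLAT-ROAD-v4.md` §4; D8.
WHY.  G7 `NE7ApeTrivialFlatEndLinks.smallField_of_trivialLetters_links` (gen 72) displayed [B8] Theorem 2 (i)'s output as a HYPOTHESIS: a unitary periodic gauge
`u₀` with `‖U^{u₀} − 1‖ ≤ r₀ ≤ 1∕2`, `‖U^{u₀}(b + e_τ) − U^{u₀}(b)‖ ≤ r₁`, plus numeric lines in `(ω, α₀, α₁, αh1)` whose sizes need `r₀ ≲ δ∕M`, `r₁ ≲ δ∕M²`.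
D7 supplies exactly that gauge with `r₀ = C₀δ∕M`, `r₁ = C₅δ∕M²`; this file chooses `ω, α₀, α₁, αh1` as the equality cases of G7's lines `hω'`, `hAα'`, `hA1'`, `hα₁h`,
verifies the remaining lines (`hr₀h`, `hωd`, `hβ`, `hσ`, `hS1`, `hb`) for `δ ≤ θ = min θ₂ (1∕Z)` with ONE explicit `Z(d, n, L)`, and bounds G7's conclusion by `K′δ²∕M²`
(`Mα₀ ≤ c_α δ`, `αh1 ≤ c_h δ`, every monomial of degree `≥ 2`).

WHAT ([folklore]; 0 def, 0 sorry; dimension `d + 1 ≥ 2`, `n : Type`).  **`smallField_of_tanCritical_flatTop`**: `∃ K′ θ > 0` (on `d`, `card n`, `L`): for all `N, k`,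
every unitary `(L^{k+1}N)`-periodic `U` with `SmallField U x` (`0 ≤ x`, `LevelSmall`, `cruxC·M²x < 1`, `thetaLoc·M²x ≤ 1∕2`, `M²x ≤ 1`), `SmallField U (δ∕M²)`
(`0 ≤ δ ≤ θ`, `δ∕M² ≤ x`), `cavgIter L (k+1) U = flat` and TANGENT-CRITICALITY ⇒ `SmallField U (K′·δ²∕M²)`.

HONEST FRAMING (page 1): bookkeeping over G7 + D7 BY NAME; the hypotheses left are the (APE) END's own (a priori small field at two radii, block-flatness,
tangent-criticality of the constrained minimiser) — ONE datum (the trivial flat one); (APE)'s bootstrap ∕ the general datum ∕ NE7 are NOT proved here; spine 0∕9;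
finite T⁴ rung (B)+1 — NOT infinite volume, NOT mass gap, NOT Clay.  Continuum YM on T⁴ ⇐ BetaPertH ∧ nine spine estimates (0/9 proved); BetaPertH ⇐ (D1) ∧ (D4) ∧
CAP+tail; G-an2-4 gates asym, D1 and NE2/3/4.
-/

set_option autoImplicit false

open scoped BigOperators Matrix.Norms.L2Operator
open NormedSpace Finset

namespace Summit.QuantumFields.BalabanUV.T4Continuum.NE7ApeTrivialFlatEndCritical

open Literature.MathematicalPhysics.QuantumFieldTheory.Balaban1983to89
open B7Prop1Explicit B7Prop2Explicit
open T4AveragingDeficitWall (IsUnitaryCfg IsSkewDir SmallField)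
open T4AveragingDeficitWallBoundary (IsPeriodicCfg)
open AveragingDeficitPeriodicCounting (IsPeriodicDir)
open AveragingDeficitMultiLevelPrep (cavgIter LevelSmall)
open MinimalActionLevels (perWin)
open MinimalActionRate (SmallField.mono)
open BlockAveragePushDirSplit (flat)
open BlockAverageVaryHolo (nbRad)
open BlockAverageVaryDisc (rho0 rho0_pos)
open B4Sect5Proof (latticeConst latticeConst_nonneg)
open B5Hk163Strip (kappa163 kappa163_pos)
open B5Hk163TorusHolderDecay (CdecD CdecD_nonneg)
open NE3HessForm (dAction)
open NE3TangentCovariantTower (dirIter)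
open NE3QbarIterCovLiftPrep (cruxC)
open NE3RightInverseSolveLetters (thetaLoc)
open NE3HatInvCurlLetters (curl1C curl1C_nonneg)
open NE7ExpLogSecondOrder (real_exp_sub_one_le_two_mul)
open NE7ApeTrivialFlatEndLinks (smallField_of_trivialLetters_links)
open NE7RepFlatLinksOfTanCritical (exists_rep_flat_links_critical)

noncomputable section

variable {d : ℕ}

set_option maxHeartbeats 800000 in
/-- **(APE) AT THE TRIVIAL FLAT DATUM FROM TANGENT-CRITICALITY.**  `∃ K′ θ > 0` (on `d`, `card n`, `L`): for all `N, k`, every unitary `(L^{k+1}N)`-periodic `U`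
with `SmallField U x` in the multi-level class, `SmallField U (δ∕M²)` with `0 ≤ δ ≤ θ`, `δ∕M² ≤ x`, `cavgIter L (k+1) U = flat` and tangent-criticality:
`SmallField U (K′δ²∕M²)`. [folklore] -/
theorem smallField_of_tanCritical_flatTop {n : Type} [Fintype n] [DecidableEq n] [Nonempty n] (hd : 1 ≤ d) {L : ℕ} (hL : 2 ≤ L) :
    ∃ K' θ : ℝ, 0 < K' ∧ 0 < θ ∧ ∀ (N : ℕ) [NeZero N] (k : ℕ)
      {U : Site (d + 1) → Fin (d + 1) → (Matrix n n ℂ)ˣ} (hU : IsUnitaryCfg U) {x δ : ℝ} (hx : 0 ≤ x) (hs : LevelSmall (d + 1) L k x)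
      (hUx : SmallField U x) (hδ : 0 ≤ δ) (hUδ : SmallField U (δ / ((L : ℝ) ^ (k + 1)) ^ 2)) (hδx : δ / ((L : ℝ) ^ (k + 1)) ^ 2 ≤ x)
      (hcritU : ∀ φ : Site (d + 1) → Fin (d + 1) → Matrix n n ℂ, IsSkewDir φ → IsPeriodicDir φ ((L ^ (k + 1) * N : ℕ) : ℤ) →
        dirIter L (k + 1) U φ = 0 → dAction U φ (perWin (d + 1) (L ^ (k + 1) * N)) = 0)
      (hflatTopU : cavgIter L (k + 1) U = flat) (hUP : IsPeriodicCfg U ((L ^ (k + 1) * N : ℕ) : ℤ))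
      (hθ : cruxC (d + 1) L * (((L : ℝ) ^ (k + 1)) ^ 2 * x) < 1) (hθl : thetaLoc (d + 1) L * (((L : ℝ) ^ (k + 1)) ^ 2 * x) ≤ 1 / 2)
      (hε : ((L : ℝ) ^ (k + 1)) ^ 2 * x ≤ 1) (hδθ : δ ≤ θ),
      SmallField U (K' * δ ^ 2 / ((L : ℝ) ^ (k + 1)) ^ 2) := by
  obtain ⟨K, hK, hG7⟩ := smallField_of_trivialLetters_links (n := n) hd hL
  obtain ⟨C₀, C₅, θ₂, hC₀, hC₅, hθ₂, hD7⟩ := exists_rep_flat_links_critical (d := d) (n := n) hL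
  have hL1 : 1 ≤ L := by omega
  have hL1r : (1 : ℝ) ≤ L := by exact_mod_cast hL1
  have hL0r : (0 : ℝ) < L := by linarith only [hL1r]
  -- the constants of G7's statement
  obtain ⟨D, hD⟩ : ∃ D : ℝ, D = ((d + 1 : ℕ) : ℝ) := ⟨_, rfl⟩
  have hD1 : 1 ≤ D := by rw [hD]; exact_mod_cast Nat.succ_le_succ (Nat.zero_le d)
  have hD0 : 0 ≤ D := by linarith only [hD1]
  have hρ0 : 0 < rho0 (d + 1) L := rho0_pos hL1
  have hLq : 0 < (L : ℝ) / (L : ℝ) ^ (d + 1) := by positivity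
  obtain ⟨S₁, hS₁⟩ : ∃ S₁ : ℝ, S₁ = 8 * (3 + 12 * D) * (2 + 2 * ((D + 1) * L)
      * (1 + ((1250 * ((nbRad (d + 1) L : ℝ) + L) + 8 * (D * L) + 2 * L) * (D * (2 * nbRad (d + 1) L + 1) ^ (d + 1)))
          / ((L : ℝ) / (L : ℝ) ^ (d + 1)))) := ⟨_, rfl⟩
  have hS₁0 : 0 ≤ S₁ := by rw [hS₁]; positivity
  obtain ⟨c₃, hc₃⟩ : ∃ c₃ : ℝ, c₃ = 4 * (3 + 12 * D) ^ 3 / rho0 (d + 1) L ^ 2 := ⟨_, rfl⟩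
  have hc₃0 : 0 ≤ c₃ := by rw [hc₃]; positivity
  have hκ : 0 < kappa163 (d + 1) := kappa163_pos _
  obtain ⟨Cd, hCd⟩ : ∃ Cd : ℝ, Cd = 2 * (CdecD d * (((d : ℝ) + 1) * (2 * ((d : ℝ) + 1))
      * ((2 + 32 / (kappa163 (d + 1) / (d + 1)) ^ 2) * latticeConst (d + 1) (kappa163 (d + 1) / (d + 1) / 2)))) := ⟨_, rfl⟩
  have hCd0 : 0 ≤ Cd := by
    rw [hCd]
    have h1 := CdecD_nonneg (d := d)
    have h2 : 0 ≤ latticeConst (d + 1) (kappa163 (d + 1) / (d + 1) / 2) := latticeConst_nonneg _ (by positivity)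
    positivity
  -- the sizes delivered by D7
  obtain ⟨cω, hcω⟩ : ∃ cω : ℝ, cω = 4 * C₀ + 136 * ((D + 1) * (D + 4)) := ⟨_, rfl⟩
  have hcω0 : 0 ≤ cω := by rw [hcω]; positivity
  obtain ⟨cα, hcα⟩ : ∃ cα : ℝ, cα = 8 * C₀ + 16 * cω := ⟨_, rfl⟩
  have hcα0 : 0 < cα := by rw [hcα]; positivity
  obtain ⟨ch, hch⟩ : ∃ ch : ℝ, ch = 4 / 3 * (4 * C₅ + 64 * C₀ * cω + 165 * cω + 64 * cω ^ 2) := ⟨_, rfl⟩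
  have hch0 : 0 ≤ ch := by rw [hch]; positivity
  have hcurl0 := curl1C_nonneg (d + 1) L
  obtain ⟨K', hK'⟩ : ∃ K' : ℝ, K' = K * (2 * (2 * curl1C (d + 1) L) * S₁ * cα
        + (Fintype.card (T4AveragingDeficitWall.Plane (d + 1)) : ℝ) * (144 * (cα * ch) + 5440 * cα ^ 3 + 8 * (ch * ch) + 304 * (ch * cα ^ 2) + 2688 * cα ^ 4))
      + Fintype.card n * Cd * (28 * ((3 + 12 * D) * cα + c₃ * cα ^ 2) ^ 2 + 4 * (c₃ * cα ^ 2)) + 28 * cα ^ 2 := ⟨_, rfl⟩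
  have hK'0 : 0 < K' := by rw [hK']; positivity
  obtain ⟨Z, hZ⟩ : ∃ Z : ℝ, Z = 4 * C₀ + 300 * D * cω + 32 * C₀ + 64 * cω + 4 * (3 + 12 * D) ^ 2 * cα / rho0 (d + 1) L ^ 2 + S₁ * cα
      + 256 * (D + 1) * L * (3 + 12 * D) * cα + 4 := ⟨_, rfl⟩
  have hZ4 : 4 ≤ Z := by
    rw [hZ]
    have : 0 ≤ 4 * C₀ + 300 * D * cω + 32 * C₀ + 64 * cω + 4 * (3 + 12 * D) ^ 2 * cα / rho0 (d + 1) L ^ 2 + S₁ * cα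
        + 256 * (D + 1) * L * (3 + 12 * D) * cα := by positivity
    linarith only [this]
  have hZ0 : 0 < Z := by linarith only [hZ4]
  refine ⟨K', min θ₂ (1 / Z), hK'0, lt_min hθ₂ (by positivity), ?_⟩
  intro N _ k U hU x δ hx hs hUx hδ hUδ hδx hcritU hflatTopU hUP hθc hθl hε1 hδθ
  haveI : NeZero (L ^ (k + 1)) := ⟨pow_ne_zero _ (by omega)⟩
  have hδθ₂ : δ ≤ θ₂ := hδθ.trans (min_le_left _ _)
  have hδZ : δ * Z ≤ 1 := by
    have h := hδθ.trans (min_le_right _ _)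
    rwa [le_div_iff₀ hZ0] at h
  have hδ4 : δ * 4 ≤ 1 := (mul_le_mul_of_nonneg_left hZ4 hδ).trans hδZ
  have hδ1 : δ ≤ 1 := by linarith only [hδ4]
  have hδsq : δ ^ 2 ≤ δ := by
    calc δ ^ 2 = δ * δ := sq δ
      _ ≤ δ * 1 := mul_le_mul_of_nonneg_left hδ1 hδ
      _ = δ := mul_one δ
  -- smallness consequences of `δ·Z ≤ 1`: every summand `p` of `Z` has `p·δ ≤ 1`
  have hle : ∀ p : ℝ, p ≤ Z → p * δ ≤ 1 := fun p hpZ => (mul_le_mul_of_nonneg_right hpZ hδ).trans (by rwa [mul_comm] at hδZ)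
  have n1 : 0 ≤ 4 * C₀ := by positivity
  have n2 : 0 ≤ 300 * D * cω := by positivity
  have n3 : 0 ≤ 32 * C₀ + 64 * cω := by positivity
  have n4 : 0 ≤ 4 * (3 + 12 * D) ^ 2 * cα / rho0 (d + 1) L ^ 2 := by positivity
  have n5 : 0 ≤ S₁ * cα := by positivity
  have n6 : 0 ≤ 256 * (D + 1) * L * (3 + 12 * D) * cα := by positivity
  have z1 : 4 * C₀ * δ ≤ 1 := hle _ (by rw [hZ]; linarith only [n2, n3, n4, n5, n6])
  have z2 : 300 * D * cω * δ ≤ 1 := hle _ (by rw [hZ]; linarith only [n1, n3, n4, n5, n6])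
  have z3 : (32 * C₀ + 64 * cω) * δ ≤ 1 := hle _ (by rw [hZ]; linarith only [n1, n2, n4, n5, n6])
  have z4 : 4 * (3 + 12 * D) ^ 2 * cα / rho0 (d + 1) L ^ 2 * δ ≤ 1 := hle _ (by rw [hZ]; linarith only [n1, n2, n3, n5, n6])
  have z5 : S₁ * cα * δ ≤ 1 := hle _ (by rw [hZ]; linarith only [n1, n2, n3, n4, n6])
  have z6 : 256 * (D + 1) * L * (3 + 12 * D) * cα * δ ≤ 1 := hle _ (by rw [hZ]; linarith only [n1, n2, n3, n4, n5])
  -- the scale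
  set M : ℝ := (L : ℝ) ^ (k + 1) with hM
  have hM1 : 1 ≤ M := one_le_pow₀ hL1r
  have hM0 : 0 < M := by linarith only [hM1]
  have hMM : M ^ 2 * (δ / M ^ 2) = δ := by field_simp
  -- D7: the gauge
  have hM2 : 1 ≤ M ^ 2 := one_le_pow₀ hM1
  have hε4 : δ / M ^ 2 ≤ 1 / 4 := (div_le_self hδ hM2).trans (by linarith only [hδ4])
  obtain ⟨u₀, hu₀, hu₀P, hr₀, hr₁⟩ := hD7 k N U (δ / M ^ 2) x hU hUP (by positivity) hε4 hUδ hflatTopU (by rw [hMM]; exact hδθ₂) hx hs hUx hθc hθl hε1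
    (fun Y hY hYP hdir => by rw [Nat.mul_comm] at hYP; have := hcritU Y hY hYP hdir; rwa [Nat.mul_comm] at this)
  -- the two radii
  have hr₀eq : C₀ * M * (δ / M ^ 2) = C₀ * δ / M := by field_simp
  have hr₁eq : C₅ * (δ / M ^ 2) = C₅ * δ / M ^ 2 := by ring
  rw [hr₀eq] at hr₀
  have hr₀M : C₀ * δ / M ≤ C₀ * δ := div_le_self (by positivity) hM1
  have hC₀δ : 4 * (C₀ * δ) ≤ 1 := by linarith only [z1]
  have hr₀0 : 0 ≤ C₀ * δ / M := by positivity
  -- `E := e^{2r₀} − 1 ≤ 4r₀ ≤ 4C₀δ∕M`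
  set E : ℝ := Real.exp (2 * (C₀ * δ / M)) - 1 with hE
  have hE0 : 0 ≤ E := by rw [hE]; linarith only [Real.add_one_le_exp (2 * (C₀ * δ / M)), hr₀0]
  have hE4 : E ≤ 4 * (C₀ * δ / M) := by
    have h := real_exp_sub_one_le_two_mul (ρ := 2 * (C₀ * δ / M)) (by positivity) (by linarith only [hr₀M, hC₀δ])
    rw [hE]; linarith only [h]
  have hE4' : E ≤ 4 * C₀ * δ := by linarith only [hE4, mul_le_mul_of_nonneg_left hr₀M (by norm_num : (0 : ℝ) ≤ 4)]
  have hexp2 : Real.exp (2 * (C₀ * δ / M)) ≤ 2 := by linarith only [hE4', hC₀δ, hE]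
  -- `ω`, `α₀`, `α₁`, `αh1` as the equality cases of G7's lines
  set ω : ℝ := M * E + 136 * ((D + 1) * (D + 4)) * (M ^ 2 * (δ / M ^ 2)) with hω
  have hωle : ω ≤ cω * δ := by
    rw [hω, hMM, hcω]
    have : M * E ≤ 4 * C₀ * δ := by
      calc M * E ≤ M * (4 * (C₀ * δ / M)) := mul_le_mul_of_nonneg_left hE4 hM0.le
        _ = 4 * C₀ * δ := by field_simp
    linarith only [this]
  have hω0 : 0 ≤ ω := by rw [hω]; positivity
  have hωM : ω / M ≤ cω * δ := (div_le_self hω0 hM1).trans hωle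
  have hωM0 : 0 ≤ ω / M := by positivity
  set α₀ : ℝ := 2 * (E + 8 * ω / M) with hα₀
  have hMα₀ : M * α₀ ≤ cα * δ := by
    rw [hα₀, hcα]
    have h1 : M * E ≤ 4 * C₀ * δ := by
      calc M * E ≤ M * (4 * (C₀ * δ / M)) := mul_le_mul_of_nonneg_left hE4 hM0.le
        _ = 4 * C₀ * δ := by field_simp
    have h2 : M * (8 * ω / M) = 8 * ω := by field_simp
    have h3 : M * (2 * (E + 8 * ω / M)) = 2 * (M * E) + 2 * (M * (8 * ω / M)) := by ring
    rw [h3, h2]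
    linarith only [h1, hωle]
  have hMα₀0 : 0 ≤ M * α₀ := by rw [hα₀]; positivity
  set α₁ : ℝ := 4 / 3 * (Real.exp (2 * (C₀ * δ / M)) * (2 * (C₅ * δ / M ^ 2)) + 2 * (8 * ω / M) * E + 165 * ω / M ^ 2 + (8 * ω / M) ^ 2) with hα₁
  set αh1 : ℝ := M ^ 2 * α₁ with hαh1
  have hαh1le : αh1 ≤ ch * δ := by
    rw [hαh1, hα₁, hch]
    have t1 : M ^ 2 * (Real.exp (2 * (C₀ * δ / M)) * (2 * (C₅ * δ / M ^ 2))) ≤ 4 * C₅ * δ := by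
      have : M ^ 2 * (Real.exp (2 * (C₀ * δ / M)) * (2 * (C₅ * δ / M ^ 2))) = Real.exp (2 * (C₀ * δ / M)) * (2 * (C₅ * δ)) := by field_simp
      rw [this]
      have := mul_le_mul_of_nonneg_right hexp2 (show 0 ≤ 2 * (C₅ * δ) by positivity)
      linarith only [this]
    have t2 : M ^ 2 * (2 * (8 * ω / M) * E) ≤ 64 * C₀ * cω * δ := by
      have : M ^ 2 * (2 * (8 * ω / M) * E) = 16 * ω * (M * E) := by field_simp; ring
      rw [this]
      have hME : M * E ≤ 4 * C₀ * δ := by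
        calc M * E ≤ M * (4 * (C₀ * δ / M)) := mul_le_mul_of_nonneg_left hE4 hM0.le
          _ = 4 * C₀ * δ := by field_simp
      have hME0 : 0 ≤ M * E := by positivity
      calc 16 * ω * (M * E) ≤ 16 * (cω * δ) * (4 * C₀ * δ) := by gcongr
        _ = 64 * C₀ * cω * δ * δ := by ring
        _ ≤ 64 * C₀ * cω * δ := mul_le_of_le_one_right (by positivity) hδ1
    have t3 : M ^ 2 * (165 * ω / M ^ 2) ≤ 165 * cω * δ := by
      have : M ^ 2 * (165 * ω / M ^ 2) = 165 * ω := by field_simp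
      rw [this]; linarith only [hωle]
    have t4 : M ^ 2 * (8 * ω / M) ^ 2 ≤ 64 * cω ^ 2 * δ := by
      have : M ^ 2 * (8 * ω / M) ^ 2 = 64 * ω ^ 2 := by field_simp; ring
      rw [this]
      have hω2 : ω ^ 2 ≤ (cω * δ) ^ 2 := pow_le_pow_left₀ hω0 hωle 2
      have : (cω * δ) ^ 2 ≤ cω ^ 2 * δ := by
        rw [mul_pow]; exact mul_le_mul_of_nonneg_left hδsq (by positivity)
      linarith only [hω2, this]
    have e : M ^ 2 * (4 / 3 * (Real.exp (2 * (C₀ * δ / M)) * (2 * (C₅ * δ / M ^ 2)) + 2 * (8 * ω / M) * E + 165 * ω / M ^ 2 + (8 * ω / M) ^ 2))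
        = 4 / 3 * (M ^ 2 * (Real.exp (2 * (C₀ * δ / M)) * (2 * (C₅ * δ / M ^ 2))) + M ^ 2 * (2 * (8 * ω / M) * E)
            + M ^ 2 * (165 * ω / M ^ 2) + M ^ 2 * (8 * ω / M) ^ 2) := by ring
    rw [e]
    linarith only [t1, t2, t3, t4]
  have hα₁0 : 0 ≤ α₁ := by rw [hα₁]; positivity
  have hαh10 : 0 ≤ αh1 := by rw [hαh1]; positivity
  -- G7
  have hG := hG7 N k hU hx hs hUx hδ hUδ hδx hcritU hflatTopU hUP hu₀ hu₀P
    (r₀ := C₀ * δ / M) (r₁ := C₅ * δ / M ^ 2) (ω := ω) (by linarith only [hr₀M, hC₀δ]) hr₀ (fun y κ τ => by rw [← hr₁eq]; exact hr₁ y κ τ)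
    (le_of_eq (by rw [hω, hE, hM, hD])) ?hωd ?hβ (α₀ := α₀) (α₁ := α₁) (αh1 := αh1) (le_of_eq (by rw [hα₀, hE, hM]))
    (le_of_eq (by rw [hα₁, hE, hM])) (le_of_eq (by rw [hαh1, hM]; field_simp)) hθc (by linarith only [hθl]) hε1 ?hσ ?hS1 ?hb
  case hωd =>
    rw [← hD]
    calc 300 * D * ω ≤ 300 * D * (cω * δ) := mul_le_mul_of_nonneg_left hωle (by positivity)
      _ = 300 * D * cω * δ := by ring
      _ ≤ 1 := z2
  case hβ =>
    have : 8 * ω / M = 8 * (ω / M) := by ring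
    rw [this]
    have h32 : (32 * C₀ + 64 * cω) * δ = 8 * (4 * C₀ * δ) + 8 * (8 * (cω * δ)) := by ring
    linarith only [hωM, hE4', z3, h32]
  case hσ =>
    rw [← hD, ← hM]
    have h1 : 4 * (3 + 12 * D) ^ 2 * M * α₀ = 4 * (3 + 12 * D) ^ 2 * (M * α₀) := by ring
    rw [h1]
    have h2 : 4 * (3 + 12 * D) ^ 2 * (M * α₀) ≤ 4 * (3 + 12 * D) ^ 2 * (cα * δ) := mul_le_mul_of_nonneg_left hMα₀ (by positivity)
    have h3 : 4 * (3 + 12 * D) ^ 2 * (cα * δ) ≤ rho0 (d + 1) L ^ 2 := by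
      have := mul_le_mul_of_nonneg_left z4 (pow_pos hρ0 2).le
      rw [mul_one] at this
      calc 4 * (3 + 12 * D) ^ 2 * (cα * δ) = rho0 (d + 1) L ^ 2 * (4 * (3 + 12 * D) ^ 2 * cα / rho0 (d + 1) L ^ 2 * δ) := by
            field_simp
        _ ≤ rho0 (d + 1) L ^ 2 := this
    linarith only [h2, h3]
  case hS1 =>
    rw [← hD, ← hM, ← hS₁]
    calc S₁ * (M * α₀) ≤ S₁ * (cα * δ) := mul_le_mul_of_nonneg_left hMα₀ hS₁0
      _ = S₁ * cα * δ := by ring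
      _ ≤ 1 := z5
  case hb =>
    rw [← hD, ← hM]
    calc 256 * (D + 1) * L * (3 + 12 * D) * (M * α₀) ≤ 256 * (D + 1) * L * (3 + 12 * D) * (cα * δ) :=
          mul_le_mul_of_nonneg_left hMα₀ (by positivity)
      _ = 256 * (D + 1) * L * (3 + 12 * D) * cα * δ := by ring
      _ ≤ 1 := z6
  -- the conclusion: every monomial is of degree ≥ 2 in `δ`
  refine SmallField.mono hG ?_
  rw [← hD, ← hM, ← hS₁, ← hc₃, ← hCd]
  refine div_le_div_of_nonneg_right ?_ (by positivity)
  have hcC : curl1C (d + 1) L / (1 - thetaLoc (d + 1) L * (M ^ 2 * x)) ≤ 2 * curl1C (d + 1) L := by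
    rw [div_le_iff₀ (by linarith only [hθl])]
    have := mul_le_mul_of_nonneg_left hθl hcurl0
    linarith only [this]
  have hcC0 : 0 ≤ curl1C (d + 1) L / (1 - thetaLoc (d + 1) L * (M ^ 2 * x)) := div_nonneg hcurl0 (by linarith only [hθl])
  set a : ℝ := M * α₀ with ha
  have haδ : a ≤ cα * δ := hMα₀
  have ha0 : 0 ≤ a := hMα₀0
  have hcαδ0 : 0 ≤ cα * δ := by positivity
  have hchδ0 : 0 ≤ ch * δ := by positivity
  -- term 1 (inside `K * (…)`)
  have T1 : 2 * (curl1C (d + 1) L / (1 - thetaLoc (d + 1) L * (M ^ 2 * x))) * S₁ * δ * a ≤ (2 * (2 * curl1C (d + 1) L) * S₁ * cα) * δ ^ 2 := by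
    calc 2 * (curl1C (d + 1) L / (1 - thetaLoc (d + 1) L * (M ^ 2 * x))) * S₁ * δ * a
        ≤ 2 * (2 * curl1C (d + 1) L) * S₁ * δ * (cα * δ) := by gcongr
      _ = (2 * (2 * curl1C (d + 1) L) * S₁ * cα) * δ ^ 2 := by ring
  -- term 2 (inside `K * (…)`)
  have T2 : 144 * (a * αh1) + 5440 * a ^ 3 + 8 * (αh1 * αh1) + 304 * (αh1 * a ^ 2) + 2688 * a ^ 4
      ≤ (144 * (cα * ch) + 5440 * cα ^ 3 + 8 * (ch * ch) + 304 * (ch * cα ^ 2) + 2688 * cα ^ 4) * δ ^ 2 := by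
    have s1 : 144 * (a * αh1) + 5440 * a ^ 3 + 8 * (αh1 * αh1) + 304 * (αh1 * a ^ 2) + 2688 * a ^ 4
        ≤ 144 * ((cα * δ) * (ch * δ)) + 5440 * (cα * δ) ^ 3 + 8 * ((ch * δ) * (ch * δ)) + 304 * ((ch * δ) * (cα * δ) ^ 2) + 2688 * (cα * δ) ^ 4 := by
      gcongr
    have hδ2 : δ ^ 3 ≤ δ ^ 2 := by
      calc δ ^ 3 = δ ^ 2 * δ := pow_succ δ 2
        _ ≤ δ ^ 2 * 1 := mul_le_mul_of_nonneg_left hδ1 (pow_nonneg hδ 2)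
        _ = δ ^ 2 := mul_one _
    have hδ3 : δ ^ 4 ≤ δ ^ 2 := by
      calc δ ^ 4 = δ ^ 3 * δ := pow_succ δ 3
        _ ≤ δ ^ 3 * 1 := mul_le_mul_of_nonneg_left hδ1 (pow_nonneg hδ 3)
        _ = δ ^ 3 := mul_one _
        _ ≤ δ ^ 2 := hδ2
    have e : 144 * ((cα * δ) * (ch * δ)) + 5440 * (cα * δ) ^ 3 + 8 * ((ch * δ) * (ch * δ)) + 304 * ((ch * δ) * (cα * δ) ^ 2) + 2688 * (cα * δ) ^ 4
        = 144 * (cα * ch) * δ ^ 2 + 5440 * cα ^ 3 * δ ^ 3 + 8 * (ch * ch) * δ ^ 2 + 304 * (ch * cα ^ 2) * δ ^ 3 + 2688 * cα ^ 4 * δ ^ 4 := by ring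
    rw [e] at s1
    have c3 : 0 ≤ 5440 * cα ^ 3 := by positivity
    have c4 : 0 ≤ 304 * (ch * cα ^ 2) := by positivity
    have c5 : 0 ≤ 2688 * cα ^ 4 := by positivity
    have f3 := mul_le_mul_of_nonneg_left hδ2 c3
    have f4 := mul_le_mul_of_nonneg_left hδ2 c4
    have f5 := mul_le_mul_of_nonneg_left hδ3 c5
    have e2 : (144 * (cα * ch) + 5440 * cα ^ 3 + 8 * (ch * ch) + 304 * (ch * cα ^ 2) + 2688 * cα ^ 4) * δ ^ 2
        = 144 * (cα * ch) * δ ^ 2 + 5440 * cα ^ 3 * δ ^ 2 + 8 * (ch * ch) * δ ^ 2 + 304 * (ch * cα ^ 2) * δ ^ 2 + 2688 * cα ^ 4 * δ ^ 2 := by ring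
    rw [e2]
    linarith only [s1, f3, f4, f5]
  -- term 3 (inside `card n * Cd * (…)`)
  have ha2 : a ^ 2 ≤ cα ^ 2 * δ ^ 2 := by rw [← mul_pow]; exact pow_le_pow_left₀ ha0 haδ 2
  have ha2' : a ^ 2 ≤ cα ^ 2 * δ := ha2.trans (mul_le_mul_of_nonneg_left hδsq (by positivity))
  have T3 : 0 + 28 * ((3 + 12 * D) * a + c₃ * a ^ 2) ^ 2 + 4 * (c₃ * a ^ 2)
      ≤ (28 * ((3 + 12 * D) * cα + c₃ * cα ^ 2) ^ 2 + 4 * (c₃ * cα ^ 2)) * δ ^ 2 := by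
    have s0 : 0 ≤ (3 + 12 * D) * a + c₃ * a ^ 2 := by positivity
    have s1 : (3 + 12 * D) * a + c₃ * a ^ 2 ≤ ((3 + 12 * D) * cα + c₃ * cα ^ 2) * δ := by
      have h1 : (3 + 12 * D) * a ≤ (3 + 12 * D) * (cα * δ) := mul_le_mul_of_nonneg_left haδ (by positivity)
      have h2 : c₃ * a ^ 2 ≤ c₃ * (cα ^ 2 * δ) := mul_le_mul_of_nonneg_left ha2' hc₃0
      have e3 : ((3 + 12 * D) * cα + c₃ * cα ^ 2) * δ = (3 + 12 * D) * (cα * δ) + c₃ * (cα ^ 2 * δ) := by ring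
      rw [e3]; exact add_le_add h1 h2
    have s2 := pow_le_pow_left₀ s0 s1 2
    have s3 : 4 * (c₃ * a ^ 2) ≤ 4 * (c₃ * (cα ^ 2 * δ ^ 2)) := by
      have := mul_le_mul_of_nonneg_left ha2 hc₃0
      linarith only [this]
    have e4 : (28 * ((3 + 12 * D) * cα + c₃ * cα ^ 2) ^ 2 + 4 * (c₃ * cα ^ 2)) * δ ^ 2
        = 28 * (((3 + 12 * D) * cα + c₃ * cα ^ 2) * δ) ^ 2 + 4 * (c₃ * (cα ^ 2 * δ ^ 2)) := by ring
    rw [e4, zero_add]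
    have := mul_le_mul_of_nonneg_left s2 (show (0 : ℝ) ≤ 28 by norm_num)
    exact add_le_add this s3
  have T5 : 28 * a ^ 2 ≤ 28 * cα ^ 2 * δ ^ 2 := by linarith only [ha2]
  have hPl0 : (0 : ℝ) ≤ Fintype.card (T4AveragingDeficitWall.Plane (d + 1)) := Nat.cast_nonneg _
  have hn0 : (0 : ℝ) ≤ Fintype.card n := Nat.cast_nonneg _
  have T12 : K * (2 * (curl1C (d + 1) L / (1 - thetaLoc (d + 1) L * (M ^ 2 * x))) * S₁ * δ * a
        + (Fintype.card (T4AveragingDeficitWall.Plane (d + 1)) : ℝ) * (144 * (a * αh1) + 5440 * a ^ 3 + 8 * (αh1 * αh1) + 304 * (αh1 * a ^ 2) + 2688 * a ^ 4))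
      ≤ K * ((2 * (2 * curl1C (d + 1) L) * S₁ * cα) * δ ^ 2
        + (Fintype.card (T4AveragingDeficitWall.Plane (d + 1)) : ℝ)
          * ((144 * (cα * ch) + 5440 * cα ^ 3 + 8 * (ch * ch) + 304 * (ch * cα ^ 2) + 2688 * cα ^ 4) * δ ^ 2)) :=
    mul_le_mul_of_nonneg_left (add_le_add T1 (mul_le_mul_of_nonneg_left T2 hPl0)) hK
  have T3' := mul_le_mul_of_nonneg_left T3 (mul_nonneg hn0 hCd0)
  rw [hK']
  have eK : (K * (2 * (2 * curl1C (d + 1) L) * S₁ * cα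
        + (Fintype.card (T4AveragingDeficitWall.Plane (d + 1)) : ℝ) * (144 * (cα * ch) + 5440 * cα ^ 3 + 8 * (ch * ch) + 304 * (ch * cα ^ 2) + 2688 * cα ^ 4))
      + Fintype.card n * Cd * (28 * ((3 + 12 * D) * cα + c₃ * cα ^ 2) ^ 2 + 4 * (c₃ * cα ^ 2)) + 28 * cα ^ 2) * δ ^ 2
      = K * ((2 * (2 * curl1C (d + 1) L) * S₁ * cα) * δ ^ 2
          + (Fintype.card (T4AveragingDeficitWall.Plane (d + 1)) : ℝ)
            * ((144 * (cα * ch) + 5440 * cα ^ 3 + 8 * (ch * ch) + 304 * (ch * cα ^ 2) + 2688 * cα ^ 4) * δ ^ 2))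
        + Fintype.card n * Cd * ((28 * ((3 + 12 * D) * cα + c₃ * cα ^ 2) ^ 2 + 4 * (c₃ * cα ^ 2)) * δ ^ 2) + 28 * cα ^ 2 * δ ^ 2 := by ring
  rw [eK]
  exact add_le_add (add_le_add T12 T3') T5

end

end Summit.QuantumFields.BalabanUV.T4Continuum.NE7ApeTrivialFlatEndCritical
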